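import Summits.Ventures.PercRepro.PurePairGraphTablesM
import Summits.Ventures.PercRepro.PurePairGraphCount

/-!
# The pure-pair gadget — the modes partition `bot`; the mode of `mk g σ` (module 6)

The bot configurations are partitioned by their mode (`modeOf`); a configuration is in mode `μ`
iff all its branches are in allowed states and the witness condition of the mode holds
(`inMode_some2_mk_iff`, `inMode_someKL_mk_iff`, `inMode_none_mk_iff`).
-/

namespace PercRepro.PurePairGraph

open MultiGraph Finset Classical StarGadgetGraph

variable {p q r s n : ℕ}

/-! ### Modes partition `bot` -/

/-- Under `Local`, the centre attaches to at most one mark. -/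
theorem att_unique {ω : Config (PE p q r s n)} (hL : Local ω) {m m' : Fin 3} (h : Att ω m)
    (h' : Att ω m') : m = m' := by
  obtain ⟨-, hL2, hL3⟩ := hL
  rcases h with ⟨rfl, hc⟩ | ⟨h1, hx1, hm1⟩ <;> rcases h' with ⟨rfl, hc'⟩ | ⟨h2, hx2, hm2⟩
  · rfl
  · exact (hL3 hc h2 m' hx2 hm2).symm
  · exact hL3 hc' h1 m hx1 hm1
  · exact hL2 h1 h2 m m' hx1 hx2 hm1 hm2

/-- The mode of a configuration: the mark the centre attaches to, if any. -/
def modeOf (ω : Config (PE p q r s n)) : Mode :=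
  if Att ω 0 then some 0 else if Att ω 1 then some 1 else if Att ω 2 then some 2 else none

/-- `InMode μ ω` iff `ω` is `Local` and `μ` is its mode. -/
theorem inMode_iff_modeOf (μ : Mode) (ω : Config (PE p q r s n)) :
    InMode μ ω ↔ Local ω ∧ μ = modeOf ω := by
  constructor
  · rintro ⟨hL, hA⟩
    refine ⟨hL, ?_⟩
    unfold modeOf
    split_ifs with h0 h1 h2
    · exact (hA 0).1 h0
    · exact (hA 1).1 h1
    · exact (hA 2).1 h2
    · rcases hμ : μ with _ | m
      · rfl
      · exact absurd ((hA m).2 hμ) (by fin_cases m <;> assumption)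
  · rintro ⟨hL, rfl⟩
    refine ⟨hL, fun m => ?_⟩
    unfold modeOf
    constructor
    · intro hm
      split_ifs with h0 h1 h2
      · rw [att_unique hL h0 hm]
      · rw [att_unique hL h1 hm]
      · rw [att_unique hL h2 hm]
      · exact absurd hm (by fin_cases m <;> assumption)
    · intro hm
      split_ifs at hm with h0 h1 h2
      · exact Option.some.inj hm ▸ h0
      · exact Option.some.inj hm ▸ h1
      · exact Option.some.inj hm ▸ h2

/-- The indicator of `bot ∧ P` splits over the modes. -/
theorem sum_modes_indicator (ω : Config (PE p q r s n)) (P : Prop) [Decidable P] :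
    (∑ μ : Mode, if InMode μ ω ∧ P then (1 : ℤ) else 0) =
      if (purePairGadget p q r s n).IsBot ω (vm 0) (vm 1) (vm 2) ∧ P then 1 else 0 := by
  simp_rw [inMode_iff_modeOf]
  rw [isBot_iff]
  by_cases hL : Local ω
  · simp only [hL, true_and]
    rw [Finset.sum_eq_single (modeOf ω)]
    · simp
    · intro μ _ hμ
      simp [hμ]
    · intro h
      exact absurd (Finset.mem_univ _) h
  · simp [hL]

/-! ### The mode of `mk g σ` -/

/-- In mode `μ` all branches are in allowed states. -/
theorem allowed_of_inMode {μ : Mode} {g : Fin 1 → Bool} {σ : BrConfig p q r s n}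
    (h : InMode μ (mk g σ)) : allowed μ σ := by
  obtain ⟨⟨hL1, -, -⟩, hA⟩ := h
  intro b
  rcases b with hub | j
  · refine ⟨fun m m' hm hm' => hL1 hub m m' hm hm', fun hx m hm => ?_⟩
    exact (hA m).1 (Or.inr ⟨hub, hx, hm⟩)
  · show pinA μ (pairState (mk g σ) j)
    by_cases hj : xcPath (pairState (mk g σ) j)
    · exact Or.inl ((hA 2).1 (Or.inl ⟨rfl, Or.inr ⟨j, hj⟩⟩))
    · exact Or.inr hj

/-- With all branches allowed in mode `μ`, `Local` holds as soon as the centre is joined to `c`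
otherwise than through a hub only when `μ = c`. -/
theorem local_mk_of_allowed {μ : Mode} {g : Fin 1 → Bool} {σ : BrConfig p q r s n}
    (hA : allowed μ σ)
    (hc : (cxOpen (mk g σ) ∨ ∃ j, xcPath (pairState (mk g σ) j)) → μ = some 2) :
    Local (mk g σ) := by
  refine ⟨fun h m m' hm hm' => (hA (Sum.inl h)).1 m m' hm hm',
    fun h h' m m' hx hx' hm hm' => ?_, fun hcx h m hx hm => ?_⟩
  · have e1 := (hA (Sum.inl h)).2 hx m hm
    have e2 := (hA (Sum.inl h')).2 hx' m' hm'
    exact Option.some.inj (e1.symm.trans e2)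
  · have e1 := (hA (Sum.inl h)).2 hx m hm
    exact Option.some.inj (e1.symm.trans (hc hcx))

/-- The witness fact of a mode, on `σ`, unfolded. -/
theorem factOf_bWpred_iff (μ : Mode) (σ : BrConfig p q r s n) :
    factOf (bWpred μ) σ ↔ (∃ h, xo (fibreState σ (Sum.inl h)) ∧
      ∃ m, μ = some m ∧ mo (fibreState σ (Sum.inl h)) m) ∨
      ∃ j, μ = some 2 ∧ xcPath (fibreState σ (Sum.inr j)) := by
  unfold factOf
  constructor
  · rintro ⟨b, hb⟩
    rcases b with h | j
    · exact Or.inl ⟨h, hb⟩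
    · exact Or.inr ⟨j, hb⟩
  · rintro (⟨h, hb⟩ | ⟨j, hb⟩)
    · exact ⟨Sum.inl h, hb⟩
    · exact ⟨Sum.inr j, hb⟩

/-- Mode M: the witness is the edge `c – x` open, a hub with open `x`-edge and open `c`-edge, or
a pair joining `x` to `c`. -/
theorem inMode_some2_mk_iff {g : Fin 1 → Bool} {σ : BrConfig p q r s n}
    (hA : allowed (some 2) σ) :
    InMode (some 2) (mk g σ) ↔ cxbit g = true ∨ factOf (bWpred (some 2)) σ := by
  rw [factOf_bWpred_iff]
  have key : ∀ m, Att (mk g σ) m ↔ m = 2 ∧ (cxbit g = true ∨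
      (∃ h, xo (fibreState σ (Sum.inl h)) ∧ ∃ m, some 2 = some m ∧ mo (fibreState σ (Sum.inl h)) m) ∨
      ∃ j, (some (2 : Fin 3) : Mode) = some 2 ∧ xcPath (fibreState σ (Sum.inr j))) := by
    intro m
    unfold Att
    rw [cxOpen_mk_iff]
    constructor
    · rintro (⟨rfl, hc | ⟨j, hj⟩⟩ | ⟨h, hx, hm⟩)
      · exact ⟨rfl, Or.inl hc⟩
      · exact ⟨rfl, Or.inr (Or.inr ⟨j, rfl, hj⟩)⟩
      · have := (hA (Sum.inl h)).2 hx m hm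
        obtain rfl := Option.some.inj this
        exact ⟨rfl, Or.inr (Or.inl ⟨h, hx, 2, rfl, hm⟩)⟩
    · rintro ⟨rfl, hc | ⟨h, hx, m', hm', hmo⟩ | ⟨j, -, hj⟩⟩
      · exact Or.inl ⟨rfl, Or.inl hc⟩
      · obtain rfl := Option.some.inj hm'
        exact Or.inr ⟨h, hx, hmo⟩
      · exact Or.inl ⟨rfl, Or.inr ⟨j, hj⟩⟩
  constructor
  · rintro ⟨-, hAtt⟩
    exact ((key 2).1 ((hAtt 2).2 rfl)).2
  · intro h
    refine ⟨local_mk_of_allowed hA fun _ => rfl, fun m => ?_⟩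
    rw [key m]
    constructor
    · rintro ⟨rfl, -⟩; rfl
    · intro hm
      obtain rfl := Option.some.inj hm
      exact ⟨rfl, h⟩

/-- Modes K and L: `c – x` closed, no pair joins `x` to `c`, and a hub with open `x`-edge carries
the mode's mark. -/
theorem inMode_someKL_mk_iff {m₀ : Fin 3} (hm₀ : m₀ ≠ 2) {g : Fin 1 → Bool}
    {σ : BrConfig p q r s n} (hA : allowed (some m₀) σ) :
    InMode (some m₀) (mk g σ) ↔ cxbit g = false ∧ factOf (bWpred (some m₀)) σ := by
  rw [factOf_bWpred_iff]
  have hnoj : ∀ j, ¬ xcPath (pairState (mk g σ) j) := by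
    intro j hj
    rcases hA (Sum.inr j) with h | h
    · exact hm₀ (Option.some.inj h)
    · exact h hj
  have key : ∀ m, Att (mk g σ) m ↔ (m = 2 ∧ cxbit g = true) ∨
      (m = m₀ ∧ ∃ h, xo (fibreState σ (Sum.inl h)) ∧
        ∃ m, some m₀ = some m ∧ mo (fibreState σ (Sum.inl h)) m) := by
    intro m
    unfold Att
    rw [cxOpen_mk_iff]
    constructor
    · rintro (⟨rfl, hc | ⟨j, hj⟩⟩ | ⟨h, hx, hm⟩)
      · exact Or.inl ⟨rfl, hc⟩
      · exact absurd hj (hnoj j)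
      · have := (hA (Sum.inl h)).2 hx m hm
        obtain rfl := Option.some.inj this
        exact Or.inr ⟨rfl, h, hx, m₀, rfl, hm⟩
    · rintro (⟨rfl, hc⟩ | ⟨rfl, h, hx, m', hm', hmo⟩)
      · exact Or.inl ⟨rfl, Or.inl hc⟩
      · obtain rfl := Option.some.inj hm'
        exact Or.inr ⟨h, hx, hmo⟩
  constructor
  · rintro ⟨-, hAtt⟩
    have h1 := (key m₀).1 ((hAtt m₀).2 rfl)
    have h2 : ¬ Att (mk g σ) 2 := fun h => hm₀ (Option.some.inj ((hAtt 2).1 h))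
    rw [key 2] at h2
    refine ⟨?_, ?_⟩
    · cases hg : cxbit g
      · rfl
      · exact absurd (Or.inl ⟨rfl, hg⟩) h2
    · rcases h1 with ⟨h, -⟩ | ⟨-, h⟩
      · exact absurd h hm₀
      · exact Or.inl h
  · rintro ⟨hg, hW⟩
    have hW' : ∃ h, xo (fibreState σ (Sum.inl h)) ∧
        ∃ m, some m₀ = some m ∧ mo (fibreState σ (Sum.inl h)) m := by
      rcases hW with hW | ⟨j, hj, -⟩
      · exact hW
      · exact absurd (Option.some.inj hj) hm₀
    refine ⟨local_mk_of_allowed hA fun hc => ?_, fun m => ?_⟩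
    · rcases hc with hc | ⟨j, hj⟩
      · rw [cxOpen_mk_iff, hg] at hc
        cases hc
      · exact absurd hj (hnoj j)
    · rw [key m]
      constructor
      · rintro (⟨-, h⟩ | ⟨rfl, -⟩)
        · rw [hg] at h; cases h
        · rfl
      · intro hm
        obtain rfl := Option.some.inj hm
        exact Or.inr ⟨rfl, hW'⟩

/-- Mode R: `c – x` closed, no pair joins `x` to `c`, no hub with open `x`-edge carries a mark. -/
theorem inMode_none_mk_iff {g : Fin 1 → Bool} {σ : BrConfig p q r s n}
    (hA : allowed none σ) : InMode none (mk g σ) ↔ cxbit g = false := by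
  have hnoj : ∀ j, ¬ xcPath (pairState (mk g σ) j) := by
    intro j hj
    rcases hA (Sum.inr j) with h | h
    · cases h
    · exact h hj
  have key : ∀ m, Att (mk g σ) m ↔ (m = 2 ∧ cxbit g = true) := by
    intro m
    unfold Att
    rw [cxOpen_mk_iff]
    constructor
    · rintro (⟨rfl, hc | ⟨j, hj⟩⟩ | ⟨h, hx, hm⟩)
      · exact ⟨rfl, hc⟩
      · exact absurd hj (hnoj j)
      · have := (hA (Sum.inl h)).2 hx m hm
        cases this
    · rintro ⟨rfl, h⟩
      exact Or.inl ⟨rfl, Or.inl h⟩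
  constructor
  · rintro ⟨-, hAtt⟩
    have h2 : ¬ Att (mk g σ) 2 := fun h => by cases (hAtt 2).1 h
    rw [key 2] at h2
    cases hg : cxbit g
    · rfl
    · exact absurd ⟨rfl, hg⟩ h2
  · intro hg
    refine ⟨local_mk_of_allowed hA fun hc => ?_, fun m => ?_⟩
    · rcases hc with hc | ⟨j, hj⟩
      · rw [cxOpen_mk_iff, hg] at hc
        cases hc
      · exact absurd hj (hnoj j)
    · rw [key m]
      constructor
      · rintro ⟨-, h⟩
        rw [hg] at h; cases h
      · intro h; cases h

end PercRepro.PurePairGraph
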